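import Mathlib
import HarnessLib

/-! # Crux `PercNearOneGluing.AdditiveGluing` (stmt-CriticalPhenomena-4576) — the half-odds identity (combinatorial core)

Support file (`--supports stmt-CriticalPhenomena-4576`; task png-dp-al5); no definitions, no named facts; pure finite algebra.

For a finite set `F` of coordinates with weights `p_e ∈ [0,1]` let `t_e` be the weight with HALF THE ODDS of `p_e`,
`t_e/(1−t_e) = ½·p_e/(1−p_e)`, i.e. `t_e (2 − p_e) = p_e`.  Then `(1 − p_e/2)·t_e = p_e/2` and `(1 − p_e/2)(1 − t_e) = 1 − p_e`,
whence the **half-odds identity**: for every nonempty `J ⊆ F`,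

  `∏_{e∈J} p_e · ∏_{e∈F∖J} (1 − p_e) = Σ_{I ⊆ J, |I| odd} 2·π_I · ∏_{e∈J∖I} t_e · ∏_{e∈F∖J} (1 − t_e)`,
  `π_I = ∏_{e∈I} (p_e/2) · ∏_{e∈F∖I} (1 − p_e/2)`

(sum over `I ⊆ J` of `(1 − (−1)^{|I|}) π_I (…)`: the unsigned sum is `∏_J p · ∏_{F∖J}(1−p)` by the binomial expansion, the signed one
is `∏_{e∈J} (−p_e/2 + (1 − p_e/2) t_e) = 0`).  Probabilistically: an edge open with probability `p` is the union of two
independent coins with probabilities `p/2` ("forced") and `t` ("free"), and the signed sum kills the all-free term.  Consequence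
(`halfOdds_sum_swap`): `Σ_{∅ ≠ J ⊆ F} (∏_J p ∏_{F∖J} (1−p)) X_J = Σ_{I ⊆ F} (1−(−1)^{|I|}) π_I · Σ_{I ⊆ J ⊆ F} (∏_{J∖I} t ∏_{F∖J}(1−t)) X_J`
for arbitrary reals `X_J` — the pattern law of the relay edges is a NONNEGATIVE combination of the laws "`I` glued, the rest at
half odds", `|I|` odd.  This is the uniform certificate behind `al5_of_halfOdds` (file `…AL5HalfOdds.lean`). [folklore]
-/

namespace Summit.CriticalPhenomena.PercolationContinuityZ3.Theorems

open Finset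

section HalfOddsIdentity

variable {ι : Type*} [DecidableEq ι]

/-- Signed binomial expansion: `Σ_{I ⊆ J} (−1)^{|I|} ∏_{I} f ∏_{J∖I} g = ∏_{J} (g − f)`. [folklore] -/
theorem halfOdds_prod_sub (f g : ι → ℝ) (J : Finset ι) :
    ∑ I ∈ J.powerset, (-1 : ℝ) ^ I.card * ((∏ e ∈ I, f e) * ∏ e ∈ J \ I, g e) = ∏ e ∈ J, (g e - f e) := by
  have h := Finset.prod_add (fun e => -f e) g J
  have hre : ∀ e ∈ J, -f e + g e = g e - f e := fun e _ => by ring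
  rw [Finset.prod_congr rfl hre] at h
  rw [h]
  refine Finset.sum_congr rfl fun I _ => ?_
  rw [Finset.prod_neg, ← mul_assoc]

/-- **The half-odds identity** (see the module docstring): for `J ⊆ F` and `t_e (2 − p_e) = p_e` on `F`,
`Σ_{I ⊆ J} (1 − (−1)^{|I|}) π_I ∏_{J∖I} t ∏_{F∖J} (1−t)` equals `∏_J p ∏_{F∖J} (1 − p)` if `J ≠ ∅` and `0` if `J = ∅`. [folklore] -/
theorem halfOdds_inner (F J : Finset ι) (hJF : J ⊆ F) (p t : ι → ℝ) (ht : ∀ e ∈ F, t e * (2 - p e) = p e) :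
    ∑ I ∈ J.powerset, (1 - (-1 : ℝ) ^ I.card) *
        (((∏ e ∈ I, p e / 2) * ∏ e ∈ F \ I, (1 - p e / 2)) * ((∏ e ∈ J \ I, t e) * ∏ e ∈ F \ J, (1 - t e))) =
      if J.Nonempty then (∏ e ∈ J, p e) * ∏ e ∈ F \ J, (1 - p e) else 0 := by
  have hkey1 : ∀ e ∈ F, (1 - p e / 2) * t e = p e / 2 := by
    intro e he; have := ht e he; linarith
  have hkey2 : ∀ e ∈ F, (1 - p e / 2) * (1 - t e) = 1 - p e := by
    intro e he; have := ht e he; linarith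
  -- split `∏_{F ∖ I}` as `∏_{J ∖ I} · ∏_{F ∖ J}` for `I ⊆ J`
  have hsplit : ∀ I ∈ J.powerset, (∏ e ∈ F \ I, (1 - p e / 2)) =
      (∏ e ∈ J \ I, (1 - p e / 2)) * ∏ e ∈ F \ J, (1 - p e / 2) := by
    intro I hI
    have hIJ : I ⊆ J := Finset.mem_powerset.1 hI
    have hdisj : Disjoint (J \ I) (F \ J) := by
      rw [Finset.disjoint_left]
      intro e he he'
      exact (Finset.mem_sdiff.1 he').2 (Finset.mem_sdiff.1 he).1
    have hunion : F \ I = (J \ I) ∪ (F \ J) := by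
      ext e
      simp only [Finset.mem_sdiff, Finset.mem_union]
      constructor
      · rintro ⟨heF, heI⟩
        by_cases heJ : e ∈ J
        · exact Or.inl ⟨heJ, heI⟩
        · exact Or.inr ⟨heF, heJ⟩
      · rintro (⟨heJ, heI⟩ | ⟨heF, heJ⟩)
        · exact ⟨hJF heJ, heI⟩
        · exact ⟨heF, fun heI => heJ (hIJ heI)⟩
    rw [hunion, Finset.prod_union hdisj]
  -- rewrite each summand
  have hterm : ∀ I ∈ J.powerset, (1 - (-1 : ℝ) ^ I.card) *
      (((∏ e ∈ I, p e / 2) * ∏ e ∈ F \ I, (1 - p e / 2)) * ((∏ e ∈ J \ I, t e) * ∏ e ∈ F \ J, (1 - t e))) =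
      (∏ e ∈ F \ J, (1 - p e)) *
        (((∏ e ∈ I, p e / 2) * ∏ e ∈ J \ I, ((1 - p e / 2) * t e)) -
          (-1 : ℝ) ^ I.card * ((∏ e ∈ I, p e / 2) * ∏ e ∈ J \ I, ((1 - p e / 2) * t e))) := by
    intro I hI
    rw [hsplit I hI, Finset.prod_mul_distrib]
    have hFJ : (∏ e ∈ F \ J, (1 - p e / 2)) * ∏ e ∈ F \ J, (1 - t e) = ∏ e ∈ F \ J, (1 - p e) := by
      rw [← Finset.prod_mul_distrib]
      exact Finset.prod_congr rfl fun e he => hkey2 e (Finset.mem_sdiff.1 he).1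
    rw [← hFJ]
    ring
  rw [Finset.sum_congr rfl hterm, ← Finset.mul_sum, Finset.sum_sub_distrib]
  -- the two binomial sums
  have hplus : ∑ I ∈ J.powerset, (∏ e ∈ I, p e / 2) * ∏ e ∈ J \ I, ((1 - p e / 2) * t e) = ∏ e ∈ J, p e := by
    rw [← Finset.prod_add]
    exact Finset.prod_congr rfl fun e he => by rw [hkey1 e (hJF he)]; ring
  have hminus : ∑ I ∈ J.powerset, (-1 : ℝ) ^ I.card * ((∏ e ∈ I, p e / 2) * ∏ e ∈ J \ I, ((1 - p e / 2) * t e)) =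
      ∏ e ∈ J, (0 : ℝ) := by
    rw [halfOdds_prod_sub]
    exact Finset.prod_congr rfl fun e he => by rw [hkey1 e (hJF he)]; ring
  rw [hplus, hminus]
  by_cases hJ : J.Nonempty
  · rw [if_pos hJ, Finset.prod_const, zero_pow (Finset.card_pos.2 hJ).ne', sub_zero, mul_comm]
  · rw [if_neg hJ, Finset.not_nonempty_iff_eq_empty.1 hJ]
    simp

/-- Re-indexing a sum over `J.powerset` (`J ⊆ F`) as a sum over `F.powerset` with the indicator `I ⊆ J`. [folklore] -/
theorem halfOdds_sum_powerset_filter (F J : Finset ι) (hJF : J ⊆ F) (f : Finset ι → ℝ) :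
    ∑ I ∈ J.powerset, f I = ∑ I ∈ F.powerset, if I ⊆ J then f I else 0 := by
  rw [← Finset.sum_filter]
  congr 1
  ext I
  simp only [Finset.mem_powerset, Finset.mem_filter]
  exact ⟨fun h => ⟨h.trans hJF, h⟩, fun h => h.2⟩

/-- **Half-odds decomposition of a pattern sum**: for arbitrary reals `X_J`,
`Σ_{∅ ≠ J ⊆ F} (∏_J p ∏_{F∖J}(1−p)) X_J = Σ_{I ⊆ F} (1 − (−1)^{|I|}) π_I Σ_{I ⊆ J ⊆ F} (∏_{J∖I} t ∏_{F∖J} (1−t)) X_J`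
(`π_I = ∏_I (p/2) ∏_{F∖I} (1 − p/2)`, `t (2 − p) = p` on `F`). [folklore] -/
theorem halfOdds_sum_swap (F : Finset ι) (p t : ι → ℝ) (ht : ∀ e ∈ F, t e * (2 - p e) = p e) (X : Finset ι → ℝ) :
    ∑ J ∈ F.powerset.filter (fun J => J.Nonempty), ((∏ e ∈ J, p e) * ∏ e ∈ F \ J, (1 - p e)) * X J =
      ∑ I ∈ F.powerset, (1 - (-1 : ℝ) ^ I.card) * ((∏ e ∈ I, p e / 2) * ∏ e ∈ F \ I, (1 - p e / 2)) *
        ∑ J ∈ F.powerset, if I ⊆ J then ((∏ e ∈ J \ I, t e) * ∏ e ∈ F \ J, (1 - t e)) * X J else 0 := by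
  -- left side as a sum over all `J` with the inner half-odds sum
  have hL : ∑ J ∈ F.powerset.filter (fun J => J.Nonempty), ((∏ e ∈ J, p e) * ∏ e ∈ F \ J, (1 - p e)) * X J =
      ∑ J ∈ F.powerset, (∑ I ∈ F.powerset, if I ⊆ J then (1 - (-1 : ℝ) ^ I.card) *
        (((∏ e ∈ I, p e / 2) * ∏ e ∈ F \ I, (1 - p e / 2)) * ((∏ e ∈ J \ I, t e) * ∏ e ∈ F \ J, (1 - t e)))
        else 0) * X J := by
    rw [Finset.sum_filter]
    refine Finset.sum_congr rfl fun J hJ => ?_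
    have hJF : J ⊆ F := Finset.mem_powerset.1 hJ
    rw [← halfOdds_sum_powerset_filter F J hJF, halfOdds_inner F J hJF p t ht]
    split_ifs <;> simp
  rw [hL]
  -- swap the two sums
  have hR : ∀ I ∈ F.powerset, (1 - (-1 : ℝ) ^ I.card) * ((∏ e ∈ I, p e / 2) * ∏ e ∈ F \ I, (1 - p e / 2)) *
      (∑ J ∈ F.powerset, if I ⊆ J then ((∏ e ∈ J \ I, t e) * ∏ e ∈ F \ J, (1 - t e)) * X J else 0) =
      ∑ J ∈ F.powerset, (if I ⊆ J then (1 - (-1 : ℝ) ^ I.card) *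
        (((∏ e ∈ I, p e / 2) * ∏ e ∈ F \ I, (1 - p e / 2)) * ((∏ e ∈ J \ I, t e) * ∏ e ∈ F \ J, (1 - t e)))
        else 0) * X J := by
    intro I _
    rw [Finset.mul_sum]
    refine Finset.sum_congr rfl fun J _ => ?_
    split_ifs <;> ring
  rw [Finset.sum_congr rfl hR, Finset.sum_comm]
  refine Finset.sum_congr rfl fun J _ => ?_
  rw [Finset.sum_mul]

end HalfOddsIdentity

end Summit.CriticalPhenomena.PercolationContinuityZ3.Theorems
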